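import Mathlib
import HarnessLib

/-!
# BalabanIR engine `BirComplexStableXYR` (stmt-HubbardSuperconductivity-14845), line
# `fat_gaussian_defect_calculus`, chapter T-end: reality of the dressed eigenvalue

Generic (project-definition-free) piece of the elementary dominant-eigenvalue analysis of the effective
1-D transfer operator.  The dressed eigenvalue `μ` is produced as the unique fixed point, in the closed disc
`‖z - 1‖ ≤ ρ`, of a Feshbach/Schur-complement map `G : ℂ → ℂ`.  When the underlying operator data are real
(time-reflection class), `G` commutes with complex conjugation on that disc.

`stub_muReal`: if `G (conj z) = conj (G z)` on the disc, `μ` is a fixed point of `G` in the disc, and fixed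
points of `G` in the disc are unique, then `μ.im = 0`.

Proof: `conj μ` lies in the disc (`‖conj μ - 1‖ = ‖conj (μ - 1)‖ = ‖μ - 1‖`) and is again a fixed point
(`G (conj μ) = conj (G μ) = conj μ`), so by uniqueness `conj μ = μ`, i.e. `μ.im = 0`
(`Complex.conj_eq_iff_im`). [folklore]
-/

set_option linter.dupNamespace false -- summit = problem name (single-conjunct summit), D-0017

namespace Summit.HubbardSuperconductivity.HubbardSuperconductivity.Theorems.TEnd

open scoped ComplexConjugate

/-- Reality of the dressed eigenvalue.  If `G : ℂ → ℂ` commutes with complex conjugation on the closed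
disc `‖z - 1‖ ≤ ρ`, `μ` is a fixed point of `G` in that disc, and fixed points of `G` in the disc are
unique, then `μ` is real (`μ.im = 0`): `conj μ` is another fixed point in the disc, hence equals `μ`.
[folklore] -/
theorem stub_muReal :
    ∀ (G : ℂ → ℂ) (ρ : ℝ) (μ : ℂ), (∀ z : ℂ, ‖z - 1‖ ≤ ρ → G (conj z) = conj (G z)) →
      (‖μ - 1‖ ≤ ρ ∧ μ = G μ) → (∀ z : ℂ, ‖z - 1‖ ≤ ρ ∧ z = G z → z = μ) → μ.im = 0 := by
  intro G ρ μ hG hμ huniq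
  obtain ⟨hμρ, hμfix⟩ := hμ
  -- `conj μ` lies in the same disc: `‖conj μ - 1‖ = ‖conj (μ - 1)‖ = ‖μ - 1‖`.
  have hnorm : ‖conj μ - 1‖ = ‖μ - 1‖ := by
    have h : conj μ - 1 = conj (μ - 1) := by
      rw [map_sub, map_one]
    rw [h, Complex.norm_conj]
  have hdisc : ‖conj μ - 1‖ ≤ ρ := hnorm ▸ hμρ
  -- `conj μ` is again a fixed point: `G (conj μ) = conj (G μ) = conj μ`.
  have hfix : conj μ = G (conj μ) := by
    rw [hG μ hμρ, ← hμfix]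
  -- Uniqueness of the fixed point in the disc forces `conj μ = μ`.
  have hconj : conj μ = μ := huniq (conj μ) ⟨hdisc, hfix⟩
  exact Complex.conj_eq_iff_im.mp hconj

end Summit.HubbardSuperconductivity.HubbardSuperconductivity.Theorems.TEnd
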